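import Literature.NumberTheory.GaloisRepresentations.ArtinRestriction
import Literature.RepresentationTheory.Semisimple.CliffordRestriction
import HarnessLib

/-!
# The restriction of a semisimple Galois representation to `Γ_M`, `M/F` Galois, is semisimple

Topic `Literature/NumberTheory/GaloisRepresentations`; a small *proofs* file (theorems only),
combining Clifford's theorem (`Literature/RepresentationTheory/Semisimple/CliffordRestriction`:
restriction of a finite-dimensional semisimple representation to a normal subgroup is
semisimple) with the restriction map `res = absGaloisRestrict F M : Γ_M →ₜ* Γ_F`
(`AbsGaloisGroup`, `ArtinRestriction`): for a Galois extension `M/F`, `res` is injective with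
normal image `Gal(F̄/e(M))`, so for a framed Galois representation `ρ : Γ_F → GL_n(k)` with
semisimple underlying representation, `ρ|_{Γ_M} = ρ ∘ res` (`FramedGaloisRep.restrictField`)
has semisimple underlying representation.

This is the (tacit) input "the `ρ_i` are semisimple, hence so are the `ρ_i|_{Γ_{E_iE_j}}`" of
the patching step in the proof of Harris–Lan–Taylor–Thorne's Cor. 7.14 (Harris–Taylor,
Thm. VII.1.9, pp. 229–231; Chenevier–Harris 2013, §3.1), where isomorphisms of restricted
representations are produced by the Chebotarev–Brauer–Nesbitt uniqueness for *semisimple*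
representations (`FramedGaloisRep.nonempty_equiv_of_hasFrobCharpolyAt_eventually`).

* `Literature.NumberTheory.GaloisRepresentations.Representation.isSemisimpleRepresentation_comp_iff_of_injective`
  — along an injective group homomorphism `f`, `ρ ∘ f` is semisimple iff the restriction of `ρ`
  to the subgroup `f(H)` is;
* `Literature.NumberTheory.GaloisRepresentations.normal_range_absGaloisRestrict` — for `M/F`
  Galois, `res(Γ_M) ◁ Γ_F`;
* `Literature.NumberTheory.GaloisRepresentations.FramedGaloisRep.isSemisimple_restrictField` — the
  result.

## References

* A. H. Clifford, *Representations induced in an invariant subgroup*, Ann. of Math. (2) 38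
  (1937), Thm. 1. [Clifford1937]
* M. Harris, R. Taylor, *The geometry and cohomology of some simple Shimura varieties*, Ann. of
  Math. Stud. 151 (2001), proof of Thm. VII.1.9. [HarrisTaylor2001]
-/

noncomputable section

open scoped MatrixGroups Matrix NumberField
open Field

namespace Literature.NumberTheory.GaloisRepresentations

/-! ## Semisimplicity along an injective homomorphism -/

section Injective

variable {k G H V : Type*} [Field k] [Group G] [Group H] [AddCommGroup V] [Module k V]

/-- Along an **injective** group homomorphism `f : H → G`, the representation `ρ ∘ f` of `H` is
semisimple iff the restriction of `ρ` to the subgroup `f(H) ≤ G` is: the subrepresentations of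
the two are the same subspaces of `V` (those stable under `ρ(f(h))`, `h ∈ H`), so the two
lattices of subrepresentations are isomorphic (Mathlib `OrderIso.complementedLattice_iff`).
[folklore] -/
theorem Representation.isSemisimpleRepresentation_comp_iff_of_injective
    (ρ : Representation k G V) (f : H →* G) :
    (Representation.IsSemisimpleRepresentation (ρ.comp f)) ↔
      (RepresentationTheory.Semisimple.Representation.restrictSubgroup ρ f.range).IsSemisimpleRepresentation :=
  OrderIso.complementedLattice_iff
    { toFun := fun W ↦ ⟨W.toSubmodule, fun g v hv ↦ by
        obtain ⟨h, hh⟩ := g.2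
        have h1 := W.apply_mem_toSubmodule h hv
        change ρ (g : G) v ∈ W.toSubmodule
        rw [← hh]
        exact h1⟩
      invFun := fun W ↦ ⟨W.toSubmodule, fun h v hv ↦ W.apply_mem_toSubmodule ⟨f h, h, rfl⟩ hv⟩
      left_inv := fun _ ↦ rfl
      right_inv := fun _ ↦ rfl
      map_rel_iff' := Iff.rfl }

end Injective

/-! ## `res(Γ_M)` is normal for `M/F` Galois -/

section Normal

variable (F M : Type*) [Field F] [Field M] [Algebra F M]

/-- **For a Galois extension `M/F` the image of `Γ_M → Γ_F` is a normal subgroup** (it is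
`Gal(F̄/e(M))` for an `F`-embedding `e` of `M`, `exists_mem_range_absGaloisRestrict_iff`, and
`e(M) ⊆ F̄` is stable under `Γ_F` because `M/F` is normal, Mathlib `AlgEquiv.restrictNormal`).
[folklore] -/
theorem normal_range_absGaloisRestrict [IsGalois F M] :
    ((absGaloisRestrict F M).range : Subgroup (absoluteGaloisGroup F)).Normal := by
  obtain ⟨e, hrange⟩ := exists_mem_range_absGaloisRestrict_iff F M
  letI : Algebra M (AlgebraicClosure F) := e.toRingHom.toAlgebra
  haveI : IsScalarTower F M (AlgebraicClosure F) :=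
    IsScalarTower.of_algebraMap_eq fun x ↦ (e.commutes x).symm
  refine ⟨fun g hg γ ↦ ?_⟩
  rw [hrange] at hg ⊢
  intro x
  -- `γ⁻¹ • e x = e y` for `y = γ⁻¹|_M x`
  set δ : AlgebraicClosure F ≃ₐ[F] AlgebraicClosure F := absoluteGaloisGroup.toAlgEquiv F γ⁻¹
  have hy : γ⁻¹ • e x = e (δ.restrictNormal M x) :=
    (AlgEquiv.restrictNormal_commutes δ M x).symm
  rw [mul_smul, mul_smul, hy, hg, ← hy, smul_inv_smul]

end Normal

/-! ## Restriction of semisimple Galois representations -/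

section Restrict

variable {F M : Type*} [Field F] [Field M] [Algebra F M]
  {k : Type*} [Field k] [TopologicalSpace k] [IsTopologicalRing k] {n : ℕ}

/-- The representation underlying `ρ|_{Γ_M}` is the representation underlying `ρ` composed with
`res : Γ_M → Γ_F`. [folklore] -/
theorem FramedGaloisRep.toRepresentation_restrictField (ρ : FramedGaloisRep F k n) :
    (ρ.restrictField M).toGaloisRep.toRepresentation =
      ρ.toGaloisRep.toRepresentation.comp (absGaloisRestrict F M : absoluteGaloisGroup M →* absoluteGaloisGroup F) :=
  MonoidHom.ext fun _ ↦ rfl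

/-- **The restriction to `Γ_M` of a semisimple Galois representation of `Γ_F` is semisimple,
for `M/F` Galois** (number fields, or any algebraic Galois extension): `res : Γ_M → Γ_F` is
injective (`absGaloisRestrict_injective`) with normal image (`normal_range_absGaloisRestrict`),
so `ρ|_{Γ_M}` is semisimple iff the restriction of `ρ` to the normal subgroup `res(Γ_M)` is
(`isSemisimpleRepresentation_comp_iff_of_injective`), which it is by Clifford's theorem
(`Representation.isSemisimpleRepresentation_restrictSubgroup`).  Harris–Taylor 2001, proof of
Thm. VII.1.9 (tacit); Clifford 1937, Thm. 1. [folklore] -/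
theorem FramedGaloisRep.isSemisimple_restrictField [IsGalois F M] (ρ : FramedGaloisRep F k n)
    (hρ : ρ.toGaloisRep.IsSemisimple) : (ρ.restrictField M).toGaloisRep.IsSemisimple := by
  haveI : ((absGaloisRestrict F M : absoluteGaloisGroup M →* absoluteGaloisGroup F).range).Normal :=
    normal_range_absGaloisRestrict F M
  change ((ρ.restrictField M).toGaloisRep.toRepresentation).IsSemisimpleRepresentation
  rw [FramedGaloisRep.toRepresentation_restrictField,
    Representation.isSemisimpleRepresentation_comp_iff_of_injective]
  exact RepresentationTheory.Semisimple.Representation.isSemisimpleRepresentation_restrictSubgroup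
    _ _ hρ

end Restrict

end Literature.NumberTheory.GaloisRepresentations
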